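import Mathlib

/-!
# Common eigenvectors, eigen-covectors and stable hyperplanes for commuting families and abelian groups
# (crux `WildQuotients.WildQuotientResolution`, stub `stub_phaseZeroHighDim`; the eigenline engine of Kollár–Szabó «going down»)

Crux stmt-ResolutionOfSingularities-15640 (`WildQuotientResolution`), registered stub `stub_phaseZeroHighDim`.
✓`StandardForm.not_primeOrbitSeparation_of_commuting_conjugates` (p824255) shows that the orbit-separation reshape
of the stub is unreachable, CONDITIONALLY on the named fact `Literature.AlgebraicGeometry.GroupActions.KollarSzaboGoingDown`
(Reichstein–Youssin 2000, appendix by Kollár–Szabó, Prop. A.2): an abelian group fixing a regular point of `X` fixes a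
point of every equivariant proper birational model. The published proof runs on ONE piece of linear algebra — «every
representation of the group has an eigenvector» — applied to the tangent space at the fixed point (an eigenLINE is a
fixed point of the exceptional divisor `ℙ(T_x X)` of the blow-up of `x`), and then inducts on the dimension.
This Mathlib-only file supplies that engine in the three forms the blow-up step consumes:

* `exists_common_eigenvector_of_commute` — a commuting family of endomorphisms of a non-zero finite-dimensional
  vector space over an algebraically closed field has a COMMON EIGENVECTOR (direct induction on the dimension:
  a non-scalar member has a proper non-zero eigenspace, stable under the whole family);
* `exists_common_eigenvector` / `exists_common_eigenvector_linearEquiv` — the same for a representation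
  `H →* End V` / `H →* (V ≃ₗ V)` of a commutative monoid (e.g. a finite abelian group, tame or wild);
* `exists_common_eigencovector_of_commute`, `exists_common_eigencovector_linearEquiv` — a common eigenvector of
  the DUAL action (`λ ∘ σ h = c • λ`, `λ ≠ 0`): for the cotangent representation on `𝔪/𝔪²` this is an
  `H`-fixed closed point of `ℙ(𝔪/𝔪²) = Proj Sym(𝔪/𝔪²)`, the exceptional divisor of the blow-up of a regular point;
* `exists_stable_hyperplane_linearEquiv` — equivalently an `H`-STABLE HYPERPLANE `W = ker λ` (`W ≠ ⊤`, the quotient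
  `V ⧸ W` one-dimensional... stated as: `W ≠ ⊤` and `∀ v ∉ W, V = W + Kv`), the form in which the fixed point upstairs
  is written in a blow-up chart.

[OURS · crux stmt-ResolutionOfSingularities-15640 · helper toward `stub_phaseZeroHighDim` (engine of the Kollár–Szabó
going-down step used by the negative side-lemma p824255 and by the eigenline bookkeeping of tame/abelian stabilisers;
NOT a proof of the stub); folklore linear algebra, counted 0; AI-level work, weaker than expert review.] [folklore]
-/

-- single-problem summit: the doubled namespace component `ResolutionOfSingularities` is forced
set_option linter.dupNamespace false

namespace Summit.ResolutionOfSingularities.ResolutionOfSingularities.Theorems.WildQuotientResolution.CommonEigenvector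

open Module Module.End Submodule

universe u v w

/-! ## Commuting families: a common eigenvector -/

/-- Inductive core (on the dimension `n`). [folklore] -/
private theorem exists_common_eigenvector_aux (K : Type u) [Field K] [IsAlgClosed K] (ι : Type w) (n : ℕ) :
    ∀ (V : Type v) [AddCommGroup V] [Module K V] [FiniteDimensional K V], Nontrivial V →
      finrank K V = n → ∀ f : ι → Module.End K V, (∀ i j, Commute (f i) (f j)) →
        ∃ v : V, v ≠ 0 ∧ ∀ i, ∃ μ : K, f i v = μ • v := by
  induction n using Nat.strong_induction_on with
  | _ n ih =>
    intro V _ _ _ hV hn f hf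
    by_cases hs : ∀ i, ∃ c : K, ∀ v : V, f i v = c • v
    · -- every member is a scalar: any non-zero vector is a common eigenvector
      obtain ⟨v, hv⟩ := exists_ne (0 : V)
      exact ⟨v, hv, fun i => by
        obtain ⟨c, hc⟩ := hs i
        exact ⟨c, hc v⟩⟩
    · push Not at hs
      obtain ⟨i₀, hi₀⟩ := hs
      -- a non-scalar member `f i₀`: an eigenvalue `μ` with a PROPER non-zero eigenspace `W`
      obtain ⟨μ, hμ⟩ := exists_eigenvalue (f i₀)
      set W : Submodule K V := (f i₀).eigenspace μ with hWdef
      have hWtop : W ≠ ⊤ := by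
        intro htop
        obtain ⟨v, hv⟩ := hi₀ μ
        apply hv
        have hvW : v ∈ W := by rw [htop]; exact Submodule.mem_top
        exact mem_eigenspace_iff.mp hvW
      obtain ⟨w₀, hw₀⟩ := hμ.exists_hasEigenvector
      have hw₀W : w₀ ∈ W := hw₀.1
      have hw₀ne : w₀ ≠ 0 := hw₀.2
      -- `W` is stable under the whole family (the members commute with `f i₀`)
      have hstab : ∀ i, ∀ x ∈ W, f i x ∈ W := by
        intro i x hx
        rw [hWdef, mem_eigenspace_iff] at hx ⊢
        have hc : f i₀ (f i x) = f i (f i₀ x) := by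
          have := hf i₀ i
          exact congrArg (fun g => g x) this.eq |>.trans rfl |> fun h => by
            simpa [Module.End.mul_apply] using h
        rw [hc, hx, LinearMap.map_smul]
      -- restrict and apply the induction hypothesis in `W`
      let g : ι → Module.End K W := fun i => (f i).restrict (hstab i)
      have hg : ∀ i j, Commute (g i) (g j) := by
        intro i j
        apply LinearMap.ext
        intro x
        apply Subtype.ext
        simp only [g, Module.End.mul_apply, LinearMap.restrict_apply]
        have := hf i j
        simpa [Module.End.mul_apply] using congrArg (fun h => h (x : V)) this.eq
      haveI : Nontrivial W := ⟨⟨⟨w₀, hw₀W⟩, 0, fun h => hw₀ne (by simpa using congrArg Subtype.val h)⟩⟩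
      have hlt : finrank K W < n := hn ▸ Submodule.finrank_lt hWtop
      obtain ⟨w, hwne, hw⟩ := ih (finrank K W) hlt W inferInstance rfl g hg
      refine ⟨(w : V), fun h => hwne (Subtype.ext h), fun i => ?_⟩
      obtain ⟨ν, hν⟩ := hw i
      refine ⟨ν, ?_⟩
      have := congrArg Subtype.val hν
      simpa [g, LinearMap.restrict_apply] using this

/-- **Common eigenvector of a commuting family.** Over an algebraically closed field `K`, a family of pairwise
commuting endomorphisms of a non-zero finite-dimensional vector space has a common eigenvector. [folklore] -/
theorem exists_common_eigenvector_of_commute {K : Type u} [Field K] [IsAlgClosed K]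
    {V : Type v} [AddCommGroup V] [Module K V] [FiniteDimensional K V] [Nontrivial V]
    {ι : Type w} (f : ι → Module.End K V) (hf : ∀ i j, Commute (f i) (f j)) :
    ∃ v : V, v ≠ 0 ∧ ∀ i, ∃ μ : K, f i v = μ • v :=
  exists_common_eigenvector_aux K ι (finrank K V) V inferInstance rfl f hf

/-- **Common eigenvector of a commutative monoid of endomorphisms** (e.g. a finite abelian group, of any order:
no tameness is needed). [folklore] -/
theorem exists_common_eigenvector {K : Type u} [Field K] [IsAlgClosed K]
    {V : Type v} [AddCommGroup V] [Module K V] [FiniteDimensional K V] [Nontrivial V]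
    {H : Type w} [CommMonoid H] (σ : H →* Module.End K V) :
    ∃ v : V, v ≠ 0 ∧ ∀ h : H, ∃ μ : K, σ h v = μ • v :=
  exists_common_eigenvector_of_commute (fun h => σ h) fun i j => by
    change σ i * σ j = σ j * σ i
    rw [← map_mul, ← map_mul, mul_comm]

/-- **Common eigenvector of a commutative monoid acting by linear automorphisms.** [folklore] -/
theorem exists_common_eigenvector_linearEquiv {K : Type u} [Field K] [IsAlgClosed K]
    {V : Type v} [AddCommGroup V] [Module K V] [FiniteDimensional K V] [Nontrivial V]
    {H : Type w} [CommMonoid H] (σ : H →* (V ≃ₗ[K] V)) :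
    ∃ v : V, v ≠ 0 ∧ ∀ h : H, ∃ μ : K, σ h v = μ • v := by
  let f : H → Module.End K V := fun h => (σ h : V →ₗ[K] V)
  have hf : ∀ i j, Commute (f i) (f j) := by
    intro i j
    change f i * f j = f j * f i
    apply LinearMap.ext
    intro x
    simp only [f, Module.End.mul_apply, LinearEquiv.coe_coe]
    rw [← LinearEquiv.mul_apply, ← LinearEquiv.mul_apply, ← map_mul, ← map_mul, mul_comm]
  obtain ⟨v, hv, h⟩ := exists_common_eigenvector_of_commute f hf
  exact ⟨v, hv, fun i => by
    obtain ⟨μ, hμ⟩ := h i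
    exact ⟨μ, by simpa [f] using hμ⟩⟩

/-! ## The dual action: common eigen-covectors and stable hyperplanes -/

/-- **Common eigen-covector of a commuting family**: a non-zero linear form `λ` with `λ ∘ f i = μ_i • λ` for all
`i` (a common eigenvector of the transposes, which again commute). Geometrically: a point of `ℙ(V) = Proj Sym V`
fixed by the family. [folklore] -/
theorem exists_common_eigencovector_of_commute {K : Type u} [Field K] [IsAlgClosed K]
    {V : Type v} [AddCommGroup V] [Module K V] [FiniteDimensional K V] [Nontrivial V]
    {ι : Type w} (f : ι → Module.End K V) (hf : ∀ i j, Commute (f i) (f j)) :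
    ∃ l : Module.Dual K V, l ≠ 0 ∧ ∀ i, ∃ μ : K, l ∘ₗ f i = μ • l := by
  -- the transposes form a commuting family on the (non-zero, finite-dimensional) dual space
  let g : ι → Module.End K (Module.Dual K V) := fun i => (f i).dualMap
  have hg : ∀ i j, Commute (g i) (g j) := by
    intro i j
    change g i * g j = g j * g i
    apply LinearMap.ext
    intro l
    simp only [g, Module.End.mul_apply, LinearMap.dualMap_apply']
    rw [LinearMap.comp_assoc, LinearMap.comp_assoc]
    congr 1
    exact (hf j i).eq
  haveI : Nontrivial (Module.Dual K V) := by
    apply (Module.finrank_pos_iff (R := K)).mp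
    rw [Subspace.dual_finrank_eq]
    exact Module.finrank_pos
  obtain ⟨l, hl, h⟩ := exists_common_eigenvector_of_commute g hg
  exact ⟨l, hl, fun i => by
    obtain ⟨μ, hμ⟩ := h i
    exact ⟨μ, by simpa [g, LinearMap.dualMap_apply'] using hμ⟩⟩

/-- **Common eigen-covector of a commutative monoid acting by linear automorphisms.** [folklore] -/
theorem exists_common_eigencovector_linearEquiv {K : Type u} [Field K] [IsAlgClosed K]
    {V : Type v} [AddCommGroup V] [Module K V] [FiniteDimensional K V] [Nontrivial V]
    {H : Type w} [CommMonoid H] (σ : H →* (V ≃ₗ[K] V)) :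
    ∃ l : Module.Dual K V, l ≠ 0 ∧ ∀ h : H, ∃ μ : K, l ∘ₗ (σ h : V →ₗ[K] V) = μ • l := by
  let f : H → Module.End K V := fun h => (σ h : V →ₗ[K] V)
  have hf : ∀ i j, Commute (f i) (f j) := by
    intro i j
    change f i * f j = f j * f i
    apply LinearMap.ext
    intro x
    simp only [f, Module.End.mul_apply, LinearEquiv.coe_coe]
    rw [← LinearEquiv.mul_apply, ← LinearEquiv.mul_apply, ← map_mul, ← map_mul, mul_comm]
  exact exists_common_eigencovector_of_commute f hf

/-- For an automorphism the eigenvalue of a non-zero eigen-covector is non-zero. [folklore] -/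
theorem eigencovector_mu_ne_zero {K : Type u} [Field K] {V : Type v} [AddCommGroup V] [Module K V]
    (e : V ≃ₗ[K] V) {l : Module.Dual K V} (hl : l ≠ 0) {μ : K} (h : l ∘ₗ (e : V →ₗ[K] V) = μ • l) :
    μ ≠ 0 := by
  rintro rfl
  apply hl
  rw [zero_smul] at h
  apply LinearMap.ext
  intro x
  have := congrArg (fun g => g (e.symm x)) h
  simpa using this

/-- **Stable hyperplane.** A commutative monoid acting by linear automorphisms on a non-zero finite-dimensional
vector space over an algebraically closed field stabilises a HYPERPLANE `W` (`W ≠ ⊤`, and `W` together with any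
vector outside it spans `V`): `W = ker λ` for a common eigen-covector `λ`. For the cotangent action of an abelian
stabiliser this is the tangent LINE whose point on the exceptional divisor is fixed (Kollár–Szabó). [folklore] -/
theorem exists_stable_hyperplane_linearEquiv {K : Type u} [Field K] [IsAlgClosed K]
    {V : Type v} [AddCommGroup V] [Module K V] [FiniteDimensional K V] [Nontrivial V]
    {H : Type w} [CommMonoid H] (σ : H →* (V ≃ₗ[K] V)) :
    ∃ W : Submodule K V, W ≠ ⊤ ∧ (∀ v : V, v ∉ W → W ⊔ K ∙ v = ⊤) ∧
      ∀ h : H, ∀ w ∈ W, σ h w ∈ W := by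
  obtain ⟨l, hl, h⟩ := exists_common_eigencovector_linearEquiv σ
  refine ⟨LinearMap.ker l, ?_, ?_, ?_⟩
  · intro htop
    exact hl (LinearMap.ker_eq_top.mp htop)
  · intro v hv
    rw [LinearMap.mem_ker] at hv
    rw [eq_top_iff]
    intro x _
    -- `x = (x - (l x / l v) • v) + (l x / l v) • v`
    have hx : x - (l x / l v) • v ∈ LinearMap.ker l := by
      rw [LinearMap.mem_ker, map_sub, map_smul, smul_eq_mul, div_mul_cancel₀ _ hv, sub_self]
    have e : x = (x - (l x / l v) • v) + (l x / l v) • v := by abel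
    rw [e]
    exact Submodule.add_mem_sup hx (Submodule.smul_mem _ _ (Submodule.mem_span_singleton_self v))
  · intro g w hw
    obtain ⟨μ, hμ⟩ := h g
    rw [LinearMap.mem_ker] at hw ⊢
    have := congrArg (fun f => f w) hμ
    simp only [LinearMap.coe_comp, Function.comp_apply, LinearEquiv.coe_coe, LinearMap.smul_apply,
      smul_eq_mul] at this
    rw [this, hw, mul_zero]

end Summit.ResolutionOfSingularities.ResolutionOfSingularities.Theorems.WildQuotientResolution.CommonEigenvector

/-! ## Appendix: split families over an arbitrary field (no algebraic closure)

For the cotangent action of a TAME abelian stabiliser over a residue field containing the relevant roots of unity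
(or any family of TRIANGULARIZABLE commuting endomorphisms) the algebraic closure is not needed: the same
induction runs on the hypothesis that every member has all its eigenvalues in `K`
(`⨆ μ, maxGenEigenspace (f i) μ = ⊤`), which passes to invariant subspaces
(`Module.End.genEigenspace_restrict_eq_top`). -/

namespace Summit.ResolutionOfSingularities.ResolutionOfSingularities.Theorems.WildQuotientResolution.CommonEigenvector

open Module Module.End Submodule

universe u' v' w'

/-- Inductive core of the split version (on the dimension `n`). [folklore] -/
private theorem exists_common_eigenvector_split_aux (K : Type u') [Field K] (ι : Type w') (n : ℕ) :
    ∀ (V : Type v') [AddCommGroup V] [Module K V] [FiniteDimensional K V], Nontrivial V →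
      finrank K V = n → ∀ f : ι → Module.End K V, (∀ i j, Commute (f i) (f j)) →
        (∀ i, ⨆ μ : K, (f i).maxGenEigenspace μ = ⊤) →
        ∃ v : V, v ≠ 0 ∧ ∀ i, ∃ μ : K, f i v = μ • v := by
  induction n using Nat.strong_induction_on with
  | _ n ih =>
    intro V _ _ _ hV hn f hf hsplit
    by_cases hs : ∀ i, ∃ c : K, ∀ v : V, f i v = c • v
    · obtain ⟨v, hv⟩ := exists_ne (0 : V)
      exact ⟨v, hv, fun i => by
        obtain ⟨c, hc⟩ := hs i
        exact ⟨c, hc v⟩⟩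
    · push Not at hs
      obtain ⟨i₀, hi₀⟩ := hs
      -- a non-scalar SPLIT member `f i₀`: some generalized eigenspace is non-zero, hence an eigenvalue `μ`
      have hex : ∃ μ : K, (f i₀).maxGenEigenspace μ ≠ ⊥ := by
        by_contra hcon
        push Not at hcon
        have htop := hsplit i₀
        simp only [hcon, iSup_bot] at htop
        exact bot_ne_top htop
      obtain ⟨μ, hμ'⟩ := hex
      have hμ : (f i₀).HasEigenvalue μ := by
        have h1 : (f i₀).HasUnifEigenvalue μ ⊤ := hμ'
        exact (hasUnifEigenvalue_iff_hasUnifEigenvalue_one (by simp)).mp h1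
      set W : Submodule K V := (f i₀).eigenspace μ with hWdef
      have hWtop : W ≠ ⊤ := by
        intro htop
        obtain ⟨v, hv⟩ := hi₀ μ
        apply hv
        have hvW : v ∈ W := by rw [htop]; exact Submodule.mem_top
        exact mem_eigenspace_iff.mp hvW
      obtain ⟨w₀, hw₀⟩ := hμ.exists_hasEigenvector
      have hw₀W : w₀ ∈ W := hw₀.1
      have hw₀ne : w₀ ≠ 0 := hw₀.2
      have hstab : ∀ i, ∀ x ∈ W, f i x ∈ W := by
        intro i x hx
        rw [hWdef, mem_eigenspace_iff] at hx ⊢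
        have hc : f i₀ (f i x) = f i (f i₀ x) := by
          have := hf i₀ i
          exact congrArg (fun g => g x) this.eq |>.trans rfl |> fun h => by
            simpa [Module.End.mul_apply] using h
        rw [hc, hx, LinearMap.map_smul]
      let g : ι → Module.End K W := fun i => (f i).restrict (hstab i)
      have hg : ∀ i j, Commute (g i) (g j) := by
        intro i j
        apply LinearMap.ext
        intro x
        apply Subtype.ext
        simp only [g, Module.End.mul_apply, LinearMap.restrict_apply]
        have := hf i j
        simpa [Module.End.mul_apply] using congrArg (fun h => h (x : V)) this.eq
      -- the restricted family is again split
      have hgsplit : ∀ i, ⨆ ν : K, (g i).maxGenEigenspace ν = ⊤ := fun i =>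
        Module.End.genEigenspace_restrict_eq_top (hstab i) (hsplit i)
      haveI : Nontrivial W := ⟨⟨⟨w₀, hw₀W⟩, 0, fun h => hw₀ne (by simpa using congrArg Subtype.val h)⟩⟩
      have hlt : finrank K W < n := hn ▸ Submodule.finrank_lt hWtop
      obtain ⟨w, hwne, hw⟩ := ih (finrank K W) hlt W inferInstance rfl g hg hgsplit
      refine ⟨(w : V), fun h => hwne (Subtype.ext h), fun i => ?_⟩
      obtain ⟨ν, hν⟩ := hw i
      refine ⟨ν, ?_⟩
      have := congrArg Subtype.val hν
      simpa [g, LinearMap.restrict_apply] using this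

/-- **Common eigenvector of a SPLIT commuting family, over any field.** If every member of a commuting family of
endomorphisms of a non-zero finite-dimensional `K`-vector space has all its eigenvalues in `K`
(`⨆ μ, maxGenEigenspace (f i) μ = ⊤`, e.g. `f i` diagonalizable over `K`: a tame element over a field with enough
roots of unity), the family has a common eigenvector. [folklore] -/
theorem exists_common_eigenvector_of_commute_of_iSup_maxGenEigenspace_eq_top {K : Type u'} [Field K]
    {V : Type v'} [AddCommGroup V] [Module K V] [FiniteDimensional K V] [Nontrivial V]
    {ι : Type w'} (f : ι → Module.End K V) (hf : ∀ i j, Commute (f i) (f j))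
    (hsplit : ∀ i, ⨆ μ : K, (f i).maxGenEigenspace μ = ⊤) :
    ∃ v : V, v ≠ 0 ∧ ∀ i, ∃ μ : K, f i v = μ • v :=
  exists_common_eigenvector_split_aux K ι (finrank K V) V inferInstance rfl f hf hsplit

/-- **Common eigenvector of a commutative monoid acting by SPLIT linear automorphisms, over any field.**
[folklore] -/
theorem exists_common_eigenvector_linearEquiv_of_iSup_maxGenEigenspace_eq_top {K : Type u'} [Field K]
    {V : Type v'} [AddCommGroup V] [Module K V] [FiniteDimensional K V] [Nontrivial V]
    {H : Type w'} [CommMonoid H] (σ : H →* (V ≃ₗ[K] V))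
    (hsplit : ∀ h : H, ⨆ μ : K, Module.End.maxGenEigenspace (σ h : Module.End K V) μ = ⊤) :
    ∃ v : V, v ≠ 0 ∧ ∀ h : H, ∃ μ : K, σ h v = μ • v := by
  let f : H → Module.End K V := fun h => (σ h : V →ₗ[K] V)
  have hf : ∀ i j, Commute (f i) (f j) := by
    intro i j
    change f i * f j = f j * f i
    apply LinearMap.ext
    intro x
    simp only [f, Module.End.mul_apply, LinearEquiv.coe_coe]
    rw [← LinearEquiv.mul_apply, ← LinearEquiv.mul_apply, ← map_mul, ← map_mul, mul_comm]
  obtain ⟨v, hv, h⟩ := exists_common_eigenvector_of_commute_of_iSup_maxGenEigenspace_eq_top f hf hsplit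
  exact ⟨v, hv, fun i => by
    obtain ⟨μ, hμ⟩ := h i
    exact ⟨μ, by simpa [f] using hμ⟩⟩

end Summit.ResolutionOfSingularities.ResolutionOfSingularities.Theorems.WildQuotientResolution.CommonEigenvector
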